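import Summits.BirchSwinnertonDyer.Rank1Residual.AdditivePotMult.PotMultCongruentPartnerMainConjecture
import Summits.BirchSwinnertonDyer.Rank1Residual.AdditivePotMult.PotMultKatoFirstUnitIndexClass
import Summits.BirchSwinnertonDyer.Rank1Residual.Additive.X4RankZeroQuadraticBranchLower
import HarnessLib

/-!
# X4(M) ∧ surj(p) ∧ `r_an = 0`, EVERY odd `p` (`p = 3` included): `BSD(E,p)` ⟸ the census record
# "first unit coefficient at index `b`" + the budget `b ≤ λ(X(E/ℚ_∞))` — the rank-`0` ENDS of row
# T-E3dM by the existing consumers (cell `b2b-bsdres`, team n1011, seat p07 (gen 3); sequel of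
# `PotMultCongruentPartnerMainConjecture.lean`, the (M) twin of n1011-p10's Route G)

HONEST FRAMING (cell `b2b-bsdres`, run/shared/lean/b2b/bsd-rank1-residual/, verbatim in every
file): the goal of the cell is to DELETE the COMBINATION-SHAPED residual classes of the
Birch–Swinnerton-Dyer formula for ALL analytic-rank `≤ 1` elliptic curves over `ℚ` — "full BSD
formula for every rank `≤ 1` curve in class `C`" assembled STRICTLY from published theorems — so
that the rank-`≤ 1` remainder becomes exactly the CONSTRUCTION-SHAPED classes, which are TYPED
(missing-input `Prop`s), NOT attempted. This is not "finishing BSD". Team n1011 (RESIDUAL-MAP §I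
N10 / N11 LOWER half on the (M) rows = X4(M) ∧ surj(p) ∧ `r_an = 0`, every odd `p`; at `p = 3` the
3 851 OPEN (M) cells of r2's E3-BUDGET census are the intended population — NO number is quoted as
closing anything): research route on CONSTRUCTION-SHAPED items; labels and marks UNCHANGED; nothing
booked — every statement below is PER PAIR modulo the named facts AND two inputs outside the kernel:
the census record (CERTIFICATE-EVIDENCE, two engines) and the budget (n1011-p10's typed
`BudgetLeLambdaAt`, EPW 2006 §3 per curve, or a congruent partner via
`budgetLeLambdaAt_of_congruentLambdaShift`); booking = director, per pair, after countersign. NO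
Literature fact minted; NO definition. Named facts as HYPOTHESES only: `hK` (Kato 2004 Thm. 17.4 (3)
half-eigenspace reading), `hDel`/`hDelX` (Delbourgo 1998 Prop. 4 and its exact (M) form), `hPal`
(Pal 2012 Thm. 3.2, live on the even branch only), `hGZK`, `hmod`, `hmodD`. Debt 0.

## What

* §0 `budgetLeLambdaAt_of_le_mordellWeilRank`: n1011-p10's typed input `BudgetLeLambdaAt p W b` is a
  THEOREM for every `b ≤ rank W(ℚ)` (`μ = 0` ⟹ generator of unit content; `T^{rank} ∣ char`) — the
  budget is a genuine per-curve input only for the EXCESS `b − rank E(ℚ)`.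
* §3 Composition of `ClassX4M.forall_quadraticBranchLowerDivisibilityAt_of_katoHalf_of_firstUnitIndex_of_budget'`
(prequel: record + budget ⟹ n1011-p10's integral `E♭`-level node for every twist model) with seat
p07 gen 2's consumers `ClassX4M.{missingLowerBoundAt_rankZero, x4MissingInputAt_rankZero_of_surj,
bsdp_rankZero_of_surj}_of_quadraticBranchLower` (n1011-p10's descent to `T = 0`, the transport to
Miller's currency over Delbourgo 1998 Prop. 4 (M), n1011-p14's `hL20`-free Kato upper chain; parity
discharged inside): `Typed.MissingLowerBoundAt W p`, `Typed.X4.MissingInputAt W p`, `BSDp W p`, and the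
`p = 3` specialisation over the odd-branch record `MultOddFirstUnitIndexAt W 3 b`; at index `b = 0`
(unit constant term) no budget at all (`…_of_firstUnitIndex_zero`, consistency with n1011-p06's
unit-row theorems).
* §4 the CONGRUENT-PARTNER forms: `…_of_congruentPartner` (budget from `TorsionIso` +
  `CongruentLambdaShift` + the partner's `μ = 0 ∧ r₁ ≤ λ`), the partner-side input from the PARTNER'S
  unit-coefficient binder when the partner is itself (M) (`ClassX4M.partnerInput_of_katoHalf_of_unitCoeffCert[_odd]`),
  and the fully composed (M)–(M) pair theorems `…_of_multPartner[_odd]`.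

What is NOT claimed: the record / budget / partner inputs (instrument tier); rows with `n₀ > B(E,p)`
and no partner; non-surjective rows (O8); `r_an = 1`; `p = 2`. X4(M) stays CONSTRUCTION-SHAPED.

References: K. Kato, Astérisque 295 (2004) Thm. 17.4 (3) [Kato2004Asterisque]; D. Delbourgo,
Compositio Math. 113 (1998) Prop. 4 [Delbourgo1998]; A. Pal, Thm. 3.2 [Pal2012]; M. Emerton,
R. Pollack, T. Weston, Invent. Math. 163 (2006) §3 [EmertonPollackWeston2006]; R. L. Miller, LMS J.
Comput. Math. 14 (2011) Def. 1.1 [Miller2011LMS]; C. Wuthrich, Doc. Math. 19 (2014) Cor. 19, Lemma 20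
[Wuthrich2014]; R. Greenberg, LNM 1716 (1999) §3 Lemma 3.1 [GreenbergLNM1716]; R. Greenberg,
V. Vatsal, Invent. Math. 142 (2000) p. 2 [GreenbergVatsal2000].
-/

set_option autoImplicit false

noncomputable section

open scoped Classical MatrixGroups ModularForm NumberField

namespace Summit.BirchSwinnertonDyer.Rank1Residual.AdditivePotMult

open CongruenceSubgroup WeierstrassCurve NumberField Literature.NumberTheory.EllipticCurves
  Literature.NumberTheory.EllipticCurves.ModularForms
  Literature.NumberTheory.EllipticCurves.Rank1Residual
  Literature.NumberTheory.EllipticCurves.Rank1Residual.Typed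
  Literature.NumberTheory.EllipticCurves.GreenbergVatsal2000
  Literature.NumberTheory.GaloisRepresentations
  Summit.BirchSwinnertonDyer.Rank1Residual.Additive
  Summit.BirchSwinnertonDyer.Rank1Residual.Additive.CensusQ6
  IsDedekindDomain

open Summit.BirchSwinnertonDyer.Rank1Residual.X1.CongruenceTransfer (TorsionIso CongruentLambdaShift)

/-! ### §0 The budget up to the rank is a THEOREM: only the excess `b − rank E(ℚ)` is a typed input -/

section BudgetFree

variable {W : WeierstrassCurve ℚ} [W.IsElliptic] [W.IsGloballyMinimal] {p : ℕ} [hp : Fact p.Prime]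

/-- **n1011-p10's typed LOWER input `BudgetLeLambdaAt p W b` HOLDS for every `b ≤ rank W(ℚ)`**
(reduction-agnostic, every `p`): for a finitely generated torsion cyclotomic dual datum with
`μ(X) = 0` and a generator `fE` of `char_Λ X`, `fE` has unit content (Greenberg–Vatsal (1) ⟺ (2):
`GreenbergVatsal2000.mu_eq_zero_iff_hasUnitContent`) and `T^{rank} ∣ fE`
(`Typed.X_pow_mordellWeilRank_dvd_of_charIdeal_eq_span`), so `b ≤ rank W(ℚ) ≤ λ(fE) = λ(X)`
(p10's `le_lambdaInvariant_of_le_mordellWeilRank` with `g₁ = fE`). So the budget is a genuine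
per-curve INPUT only for the EXCESS `b − rank E(ℚ)` (the `Ш(E)[p^∞]` / Tamagawa share of `λ`): on
MINIMAL rows `b = rank E(ℚ)` every `…_of_budget` theorem of this chain is unconditional in the
budget (cf. `minimalPackage_of_katoHalf_of_norm_coeff_mordellWeilRank`).
[cite: GreenbergLNM1716, §3 Lemma 3.1 (T^{rank} ∣ char)] [cite: GreenbergVatsal2000, p. 2, (1)–(2)] -/
theorem budgetLeLambdaAt_of_le_mordellWeilRank {b : ℕ} (hb : b ≤ W.mordellWeilRank) :
    BudgetLeLambdaAt p W b := by
  intro κ γ _ hγ _ D _ hX hmu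
  obtain ⟨fE, hchar, -⟩ := exists_charIdeal_eq_span_singleton p D
  have hfE : HasUnitContent fE :=
    (GreenbergVatsal2000.mu_eq_zero_iff_hasUnitContent D hX hchar).mp hmu
  exact le_lambdaInvariant_of_le_mordellWeilRank hγ D hX hchar hfE (dvd_refl fE) hb

/-- `BudgetLeLambdaAt p W 0` holds (the case `b = 0 ≤ rank`). -/
theorem budgetLeLambdaAt_zero : BudgetLeLambdaAt p W 0 :=
  budgetLeLambdaAt_of_le_mordellWeilRank (Nat.zero_le _)

end BudgetFree

/-! ### §3 The rank-`0` ENDS on X4(M) ∧ surj(p), EVERY odd `p`, by the existing consumers -/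

section Ends

variable {W : WeierstrassCurve ℚ} [W.IsElliptic] [W.IsGloballyMinimal] {p : ℕ} [hp : Fact p.Prime]

/-- **X4(M) ∧ surj(p) ∧ `r_an = 0`, EVERY odd `p`: record (of the parity of `(p−1)/2`) at index `b` +
budget ⟹ the LOWER half `ord_p #Ш_an(E) ≤ ord_p #Ш(E)` (`Typed.MissingLowerBoundAt W p`)** — gen 2's
`ClassX4M.missingLowerBoundAt_rankZero_of_quadraticBranchLower` on §2 (Delbourgo 1998 Prop. 4 (M) exact
`hDelX`, Pal `hPal` on the even branch, GZK, modularity). PER PAIR modulo the record and the budget;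
X4(M) stays CONSTRUCTION-SHAPED; nothing booked. [cite: Kato2004Asterisque, Thm. 17.4 (3) (p. 273)]
[cite: Delbourgo1998, Prop. 4 (p. 144), §2.2 Lemma (ii) (p. 139)] [cite: Pal2012, Thm. 3.2]
[cite: EmertonPollackWeston2006, Cor. 3.2.5 and Thm. 3.1.1 (source of the typed input)] -/
theorem ClassX4M.missingLowerBoundAt_rankZero_of_katoHalf_of_firstUnitIndex_of_budget
    (hK : Wuthrich2014.kato_halfEigenCharIdeal_dvd_cyclotomicPrime_of_surjective)
    (hDelX : Delbourgo1998.prop4_rankZero_constantCoeff_eq_unit_mul_of_potMult)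
    (hPal : Pal2012.thm32_sqrt_mul_realPeriodRat_twist_eq_of_prime_one_mod_four)
    (hGZK : rank_eq_analyticRank_of_analyticRank_le_one) (hmod : hasEntireLFunction_rat)
    (hmodD : nonempty_modularParametrizationData)
    (hX : ClassX4M W p) (hsurj : Surj W p) (hr : W.analyticRank = 0) {b : ℕ}
    (hrec : (p % 4 = 1 → MultFirstUnitIndexAt W p b) ∧ (p % 4 = 3 → MultOddFirstUnitIndexAt W p b))
    (hbud : BudgetLeLambdaAt p W b) : MissingLowerBoundAt W p :=
  ClassX4M.missingLowerBoundAt_rankZero_of_quadraticBranchLower hDelX hPal hGZK hmod hmodD hX hr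
    (fun V _ _ hVW ↦
      hX.forall_quadraticBranchLowerDivisibilityAt_of_katoHalf_of_firstUnitIndex_of_budget' hK hsurj hrec
        hbud V hVW)

/-- **X4(M) ∧ surj(p) ∧ `r_an = 0`, EVERY odd `p`: record + budget ⟹ the WHOLE typed input
`Typed.X4.MissingInputAt W p` of X4♯ at the pair** (upper half = n1011-p14's `hL20`-free chain; gen 2's
`ClassX4M.x4MissingInputAt_rankZero_of_surj_of_quadraticBranchLower`). [cite: Kato2004Asterisque, Thm. 17.4 (3) (p. 273)]
[cite: Delbourgo1998, Prop. 4 (p. 144)] [cite: Pal2012, Thm. 3.2] [cite: EmertonPollackWeston2006, Cor. 3.2.5 and Thm. 3.1.1 (source of the typed input)] -/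
theorem ClassX4M.x4MissingInputAt_rankZero_of_katoHalf_of_firstUnitIndex_of_budget
    (hK : Wuthrich2014.kato_halfEigenCharIdeal_dvd_cyclotomicPrime_of_surjective)
    (hDel : Delbourgo1998.prop4_rankZero_pow_dvd_constantCoeff)
    (hDelX : Delbourgo1998.prop4_rankZero_constantCoeff_eq_unit_mul_of_potMult)
    (hPal : Pal2012.thm32_sqrt_mul_realPeriodRat_twist_eq_of_prime_one_mod_four)
    (hGZK : rank_eq_analyticRank_of_analyticRank_le_one) (hmod : hasEntireLFunction_rat)
    (hmodD : nonempty_modularParametrizationData)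
    (hX : ClassX4M W p) (hsurj : Surj W p) (hr : W.analyticRank = 0) {b : ℕ}
    (hrec : (p % 4 = 1 → MultFirstUnitIndexAt W p b) ∧ (p % 4 = 3 → MultOddFirstUnitIndexAt W p b))
    (hbud : BudgetLeLambdaAt p W b) : X4.MissingInputAt W p :=
  ClassX4M.x4MissingInputAt_rankZero_of_surj_of_quadraticBranchLower hDel hDelX hPal hGZK hmod hmodD hK
    hX hr hsurj
    (fun V _ _ hVW ↦
      hX.forall_quadraticBranchLowerDivisibilityAt_of_katoHalf_of_firstUnitIndex_of_budget' hK hsurj hrec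
        hbud V hVW)

/-- **X4(M) ∧ surj(p) ∧ `r_an = 0`, EVERY odd `p` (`p = 3` included): `BSD(E,p)` ⟸ the census record
at index `b` + the budget `BudgetLeLambdaAt p E b`** (modulo {hK, hDel, hDelX, hPal, hGZK, hmod, hmodD});
gen 2's `ClassX4M.bsdp_rankZero_of_surj_of_quadraticBranchLower`. With §0 the budget may come from a
congruent partner. PER PAIR; EVIDENCE-tier inputs; X4(M) stays CONSTRUCTION-SHAPED; nothing booked.
[cite: Kato2004Asterisque, Thm. 17.4 (3) (p. 273)] [cite: Delbourgo1998, Prop. 4 (p. 144)]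
[cite: Pal2012, Thm. 3.2] [cite: Miller2011LMS, §1 and Def. 1.1]
[cite: EmertonPollackWeston2006, Cor. 3.2.5 and Thm. 3.1.1 (source of the typed input)] -/
theorem ClassX4M.bsdp_rankZero_of_surj_of_katoHalf_of_firstUnitIndex_of_budget
    (hK : Wuthrich2014.kato_halfEigenCharIdeal_dvd_cyclotomicPrime_of_surjective)
    (hDel : Delbourgo1998.prop4_rankZero_pow_dvd_constantCoeff)
    (hDelX : Delbourgo1998.prop4_rankZero_constantCoeff_eq_unit_mul_of_potMult)
    (hPal : Pal2012.thm32_sqrt_mul_realPeriodRat_twist_eq_of_prime_one_mod_four)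
    (hGZK : rank_eq_analyticRank_of_analyticRank_le_one) (hmod : hasEntireLFunction_rat)
    (hmodD : nonempty_modularParametrizationData)
    (hX : ClassX4M W p) (hsurj : Surj W p) (hr : W.analyticRank = 0) {b : ℕ}
    (hrec : (p % 4 = 1 → MultFirstUnitIndexAt W p b) ∧ (p % 4 = 3 → MultOddFirstUnitIndexAt W p b))
    (hbud : BudgetLeLambdaAt p W b) : BSDp W p :=
  ClassX4M.bsdp_rankZero_of_surj_of_quadraticBranchLower hDel hDelX hPal hGZK hmod hmodD hK hX hr hsurj
    (fun V _ _ hVW ↦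
      hX.forall_quadraticBranchLowerDivisibilityAt_of_katoHalf_of_firstUnitIndex_of_budget' hK hsurj hrec
        hbud V hVW)

/-- **`p = 3` specialisation (the N11 (M) rows: 3 851 OPEN `r_an = 0` cells of record at `p = 3`, count
of r2's E3-BUDGET; nothing closed by this statement):** X4(M) ∧ surj(3) ∧ `r_an = 0`, record
`MultOddFirstUnitIndexAt W 3 b` (odd branch: `3 ≡ 3 (mod 4)`, twist by `−3`, `Ω⁻`) + budget ⟹ `BSD(E,3)`;
no Pal hypothesis is live at `3` but the signature keeps it (parity-uniform chain).
[cite: Kato2004Asterisque, Thm. 17.4 (3) (p. 273)] [cite: Delbourgo1998, Prop. 4 (p. 144)] [cite: Miller2011LMS, Def. 1.1] -/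
theorem ClassX4M.bsdp_three_rankZero_of_surj_of_katoHalf_of_firstUnitIndex_of_budget [Fact (Nat.Prime 3)]
    {W : WeierstrassCurve ℚ} [W.IsElliptic] [W.IsGloballyMinimal]
    (hK : Wuthrich2014.kato_halfEigenCharIdeal_dvd_cyclotomicPrime_of_surjective)
    (hDel : Delbourgo1998.prop4_rankZero_pow_dvd_constantCoeff)
    (hDelX : Delbourgo1998.prop4_rankZero_constantCoeff_eq_unit_mul_of_potMult)
    (hPal : Pal2012.thm32_sqrt_mul_realPeriodRat_twist_eq_of_prime_one_mod_four)
    (hGZK : rank_eq_analyticRank_of_analyticRank_le_one) (hmod : hasEntireLFunction_rat)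
    (hmodD : nonempty_modularParametrizationData)
    (hX : ClassX4M W 3) (hsurj : Surj W 3) (hr : W.analyticRank = 0) {b : ℕ}
    (hrec : MultOddFirstUnitIndexAt W 3 b) (hbud : BudgetLeLambdaAt 3 W b) : BSDp W 3 :=
  hX.bsdp_rankZero_of_surj_of_katoHalf_of_firstUnitIndex_of_budget hK hDel hDelX hPal hGZK hmod hmodD
    hsurj hr ⟨fun h ↦ absurd h (by norm_num), fun _ ↦ hrec⟩ hbud

/-- **Index `0` (UNIT constant term) needs NO budget: X4(M) ∧ surj(p) ∧ `r_an = 0`, EVERY odd `p`,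
record at index `0` (the constant term of `ϖ·L_p^±(f_{E♭}, ±1, ω^{(p−1)/2}, T)` is a `p`-adic unit)
⟹ `BSD(E,p)`** (`budgetLeLambdaAt_zero`). Same population as n1011-p06's UNIT-ROW theorems
(`ClassX4M.chiBranchRatCharEqMultOddAt_of_unitLValue_of_surj`, `Additive/ChiBranchRatLowerDvdUnitRows*.lean`,
read through interpolation) — a CONSISTENCY of the two chains; nothing new is covered and nothing is
booked. [cite: Kato2004Asterisque, Thm. 17.4 (3) (p. 273)] [cite: Delbourgo1998, Prop. 4 (p. 144)]
[cite: Miller2011LMS, Def. 1.1] -/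
theorem ClassX4M.bsdp_rankZero_of_surj_of_katoHalf_of_firstUnitIndex_zero
    (hK : Wuthrich2014.kato_halfEigenCharIdeal_dvd_cyclotomicPrime_of_surjective)
    (hDel : Delbourgo1998.prop4_rankZero_pow_dvd_constantCoeff)
    (hDelX : Delbourgo1998.prop4_rankZero_constantCoeff_eq_unit_mul_of_potMult)
    (hPal : Pal2012.thm32_sqrt_mul_realPeriodRat_twist_eq_of_prime_one_mod_four)
    (hGZK : rank_eq_analyticRank_of_analyticRank_le_one) (hmod : hasEntireLFunction_rat)
    (hmodD : nonempty_modularParametrizationData)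
    (hX : ClassX4M W p) (hsurj : Surj W p) (hr : W.analyticRank = 0)
    (hrec : (p % 4 = 1 → MultFirstUnitIndexAt W p 0) ∧ (p % 4 = 3 → MultOddFirstUnitIndexAt W p 0)) :
    BSDp W p :=
  hX.bsdp_rankZero_of_surj_of_katoHalf_of_firstUnitIndex_of_budget hK hDel hDelX hPal hGZK hmod hmodD
    hsurj hr hrec budgetLeLambdaAt_zero

end Ends

/-! ### §4 The CONGRUENT-PARTNER forms: the budget from a partner, the partner's input from ITS certificate -/

section PartnerForms

variable {W W₁ : WeierstrassCurve ℚ} [W.IsElliptic] [W.IsGloballyMinimal] [W₁.IsElliptic]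
  [W₁.IsGloballyMinimal] {p : ℕ} [hp : Fact p.Prime]

omit [W₁.IsGloballyMinimal] in
/-- **The partner-side input from the PARTNER'S certificate, (M) partner, `p ≡ 1 (mod 4)`:** if the
partner `W₁` is itself X4(M) ∧ surj(p) with n1011-p06's binder `MultBranchUnitCoeffCert W₁ p` (SOME unit
coefficient) and `r₁ ≤ rank W₁(ℚ)`, then every finitely generated cyclotomic dual datum of
`Sel_{p^∞}(W₁/ℚ_∞)` is torsion with `μ = 0` and `r₁ ≤ λ` — exactly the hypothesis `h₁` of
`budgetLeLambdaAt_of_congruentLambdaShift` (`PotMultKatoFirstUnitIndexClass` §1 + Greenberg–Vatsal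
(1) ⟺ (2) + p10's `le_lambdaInvariant_of_le_mordellWeilRank`). (A good-ordinary partner is served by
n1011-p10's `CongruentPartnerMainConjectureGord.lean`; a multiplicative one by X1/X11a.)
[cite: Kato2004Asterisque, Thm. 17.4 (3) (p. 273)] [cite: GreenbergVatsal2000, p. 2, (1)–(2)]
[cite: GreenbergLNM1716, §3 Lemma 3.1] -/
theorem ClassX4M.partnerInput_of_katoHalf_of_unitCoeffCert
    (hK : Wuthrich2014.kato_halfEigenCharIdeal_dvd_cyclotomicPrime_of_surjective)
    (hmodD : nonempty_modularParametrizationData)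
    (hX₁ : ClassX4M W₁ p) (hsurj₁ : Surj W₁ p) (hp4 : p % 4 = 1)
    (hcert₁ : MultBranchUnitCoeffCert W₁ p) {r₁ : ℕ} (hr₁ : r₁ ≤ W₁.mordellWeilRank)
    {κ : ZpExtension ℚ p} {γ : Field.absoluteGaloisGroup ℚ}
    (hκ : κ.IsCyclotomic) (hγ : κ.IsTopGenerator γ) (hγ' : IsCyclotomicVariable p γ)
    (D₁ : W₁.SelmerDualData κ γ) [Module.Finite (IwasawaAlgebra p) D₁.X] :
    D₁.IsTorsion ∧ D₁.mu = 0 ∧ r₁ ≤ lambdaInvariant p D₁.X := by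
  obtain ⟨fE₁, hchar, -⟩ := exists_charIdeal_eq_span_singleton p D₁
  obtain ⟨hXt, hfE, -⟩ :=
    hX₁.mu_eq_zero_of_katoHalf_of_unitCoeffCert hK hmodD hsurj₁ hp4 hcert₁ hκ hγ hγ' D₁ hchar
  exact ⟨hXt, (GreenbergVatsal2000.mu_eq_zero_iff_hasUnitContent D₁ hXt hchar).mpr hfE,
    le_lambdaInvariant_of_le_mordellWeilRank hγ D₁ hXt hchar hfE (dvd_refl fE₁) hr₁⟩

omit [W₁.IsGloballyMinimal] in
/-- **Partner-side input, (M) partner, `p ≡ 3 (mod 4)` (`p = 3` included)**, binder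
`MultOddBranchUnitCoeffCert W₁ p`. [cite: Kato2004Asterisque, Thm. 17.4 (3) (p. 273)]
[cite: GreenbergVatsal2000, p. 2, (1)–(2)] [cite: GreenbergLNM1716, §3 Lemma 3.1] -/
theorem ClassX4M.partnerInput_of_katoHalf_of_unitCoeffCert_odd
    (hK : Wuthrich2014.kato_halfEigenCharIdeal_dvd_cyclotomicPrime_of_surjective)
    (hmodD : nonempty_modularParametrizationData)
    (hX₁ : ClassX4M W₁ p) (hsurj₁ : Surj W₁ p) (hp4 : p % 4 = 3)
    (hcert₁ : MultOddBranchUnitCoeffCert W₁ p) {r₁ : ℕ} (hr₁ : r₁ ≤ W₁.mordellWeilRank)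
    {κ : ZpExtension ℚ p} {γ : Field.absoluteGaloisGroup ℚ}
    (hκ : κ.IsCyclotomic) (hγ : κ.IsTopGenerator γ) (hγ' : IsCyclotomicVariable p γ)
    (D₁ : W₁.SelmerDualData κ γ) [Module.Finite (IwasawaAlgebra p) D₁.X] :
    D₁.IsTorsion ∧ D₁.mu = 0 ∧ r₁ ≤ lambdaInvariant p D₁.X := by
  obtain ⟨fE₁, hchar, -⟩ := exists_charIdeal_eq_span_singleton p D₁
  obtain ⟨hXt, hfE, -⟩ :=
    hX₁.mu_eq_zero_of_katoHalf_of_unitCoeffCert_odd hK hmodD hsurj₁ hp4 hcert₁ hκ hγ hγ' D₁ hchar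
  exact ⟨hXt, (GreenbergVatsal2000.mu_eq_zero_iff_hasUnitContent D₁ hXt hchar).mpr hfE,
    le_lambdaInvariant_of_le_mordellWeilRank hγ D₁ hXt hchar hfE (dvd_refl fE₁) hr₁⟩

/-- **X4(M) ∧ surj(p) ∧ `r_an = 0`, EVERY odd `p`: `BSD(E,p)` ⟸ the record at index `b` + a CONGRUENT
PARTNER** — `E[p] ≅ E₁[p]` (`TorsionIso`), X1's typed schema `CongruentLambdaShift W W₁ p e` (per pair:
EPW 2006 Thm. 3.3.3), a partner `W₁` (ANY reduction at `p`) whose finitely generated cyclotomic dual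
data are torsion with `μ = 0` and `r₁ ≤ λ` (`h₁`; for an (M) partner:
`ClassX4M.partnerInput_of_katoHalf_of_unitCoeffCert[_odd]`), and `b ≤ r₁ + e`
(`budgetLeLambdaAt_of_congruentLambdaShift` + §3). PER PAIR; X4(M) stays CONSTRUCTION-SHAPED; nothing
booked. [cite: Kato2004Asterisque, Thm. 17.4 (3) (p. 273)] [cite: EmertonPollackWeston2006, Thm. 3.3.3 (source of the typed schema)]
[cite: Delbourgo1998, Prop. 4 (p. 144)] [cite: Pal2012, Thm. 3.2] [cite: Miller2011LMS, Def. 1.1] -/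
theorem ClassX4M.bsdp_rankZero_of_surj_of_katoHalf_of_firstUnitIndex_of_congruentPartner
    (hK : Wuthrich2014.kato_halfEigenCharIdeal_dvd_cyclotomicPrime_of_surjective)
    (hDel : Delbourgo1998.prop4_rankZero_pow_dvd_constantCoeff)
    (hDelX : Delbourgo1998.prop4_rankZero_constantCoeff_eq_unit_mul_of_potMult)
    (hPal : Pal2012.thm32_sqrt_mul_realPeriodRat_twist_eq_of_prime_one_mod_four)
    (hGZK : rank_eq_analyticRank_of_analyticRank_le_one) (hmod : hasEntireLFunction_rat)
    (hmodD : nonempty_modularParametrizationData)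
    (hX : ClassX4M W p) (hsurj : Surj W p) (hr : W.analyticRank = 0) {b : ℕ}
    (hrec : (p % 4 = 1 → MultFirstUnitIndexAt W p b) ∧ (p % 4 = 3 → MultOddFirstUnitIndexAt W p b))
    {e : ℤ} {r₁ : ℕ} (hiso : TorsionIso W W₁ p) (hG : CongruentLambdaShift W W₁ p e)
    (h₁ : ∀ {κ : ZpExtension ℚ p} {γ : Field.absoluteGaloisGroup ℚ},
      κ.IsCyclotomic → κ.IsTopGenerator γ → IsCyclotomicVariable p γ →
      ∀ (D₁ : W₁.SelmerDualData κ γ) [Module.Finite (IwasawaAlgebra p) D₁.X],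
        D₁.IsTorsion ∧ D₁.mu = 0 ∧ r₁ ≤ lambdaInvariant p D₁.X)
    (hb : (b : ℤ) ≤ r₁ + e) : BSDp W p :=
  hX.bsdp_rankZero_of_surj_of_katoHalf_of_firstUnitIndex_of_budget hK hDel hDelX hPal hGZK hmod hmodD
    hsurj hr hrec (budgetLeLambdaAt_of_congruentLambdaShift hiso hG h₁ hb)

/-- **(M)–(M) congruent pair, `p ≡ 3 (mod 4)` (`p = 3` included), fully composed**: `W` X4(M) ∧ surj(p)
∧ `r_an = 0` with the record at index `b`; partner `W₁` X4(M) ∧ surj(p) with ANY unit coefficient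
(`MultOddBranchUnitCoeffCert W₁ p`) and `r₁ ≤ rank W₁(ℚ)`; `E[p] ≅ E₁[p]`, `CongruentLambdaShift W W₁ p e`,
`b ≤ r₁ + e` ⟹ `BSD(E,p)`. [cite: Kato2004Asterisque, Thm. 17.4 (3) (p. 273)]
[cite: EmertonPollackWeston2006, Thm. 3.3.3 (source of the typed schema)] [cite: Delbourgo1998, Prop. 4 (p. 144)]
[cite: Miller2011LMS, Def. 1.1] -/
theorem ClassX4M.bsdp_rankZero_of_surj_of_katoHalf_of_firstUnitIndex_of_multPartner_odd
    (hK : Wuthrich2014.kato_halfEigenCharIdeal_dvd_cyclotomicPrime_of_surjective)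
    (hDel : Delbourgo1998.prop4_rankZero_pow_dvd_constantCoeff)
    (hDelX : Delbourgo1998.prop4_rankZero_constantCoeff_eq_unit_mul_of_potMult)
    (hPal : Pal2012.thm32_sqrt_mul_realPeriodRat_twist_eq_of_prime_one_mod_four)
    (hGZK : rank_eq_analyticRank_of_analyticRank_le_one) (hmod : hasEntireLFunction_rat)
    (hmodD : nonempty_modularParametrizationData)
    (hX : ClassX4M W p) (hsurj : Surj W p) (hr : W.analyticRank = 0) (hp4 : p % 4 = 3) {b : ℕ}
    (hrec : MultOddFirstUnitIndexAt W p b)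
    (hX₁ : ClassX4M W₁ p) (hsurj₁ : Surj W₁ p) (hcert₁ : MultOddBranchUnitCoeffCert W₁ p) {r₁ : ℕ}
    (hr₁ : r₁ ≤ W₁.mordellWeilRank) {e : ℤ} (hiso : TorsionIso W W₁ p)
    (hG : CongruentLambdaShift W W₁ p e) (hb : (b : ℤ) ≤ r₁ + e) : BSDp W p :=
  hX.bsdp_rankZero_of_surj_of_katoHalf_of_firstUnitIndex_of_congruentPartner hK hDel hDelX hPal hGZK hmod
    hmodD hsurj hr ⟨fun h ↦ absurd hp4 (by omega), fun _ ↦ hrec⟩ hiso hG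
    (fun hκ hγ hγ' D₁ _ ↦
      hX₁.partnerInput_of_katoHalf_of_unitCoeffCert_odd hK hmodD hsurj₁ hp4 hcert₁ hr₁ hκ hγ hγ' D₁)
    hb

/-- **(M)–(M) congruent pair, `p ≡ 1 (mod 4)`, fully composed** (even branch; `hPal` live).
[cite: Kato2004Asterisque, Thm. 17.4 (3) (p. 273)] [cite: EmertonPollackWeston2006, Thm. 3.3.3 (source of the typed schema)]
[cite: Delbourgo1998, Prop. 4 (p. 144)] [cite: Pal2012, Thm. 3.2] [cite: Miller2011LMS, Def. 1.1] -/
theorem ClassX4M.bsdp_rankZero_of_surj_of_katoHalf_of_firstUnitIndex_of_multPartner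
    (hK : Wuthrich2014.kato_halfEigenCharIdeal_dvd_cyclotomicPrime_of_surjective)
    (hDel : Delbourgo1998.prop4_rankZero_pow_dvd_constantCoeff)
    (hDelX : Delbourgo1998.prop4_rankZero_constantCoeff_eq_unit_mul_of_potMult)
    (hPal : Pal2012.thm32_sqrt_mul_realPeriodRat_twist_eq_of_prime_one_mod_four)
    (hGZK : rank_eq_analyticRank_of_analyticRank_le_one) (hmod : hasEntireLFunction_rat)
    (hmodD : nonempty_modularParametrizationData)
    (hX : ClassX4M W p) (hsurj : Surj W p) (hr : W.analyticRank = 0) (hp4 : p % 4 = 1) {b : ℕ}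
    (hrec : MultFirstUnitIndexAt W p b)
    (hX₁ : ClassX4M W₁ p) (hsurj₁ : Surj W₁ p) (hcert₁ : MultBranchUnitCoeffCert W₁ p) {r₁ : ℕ}
    (hr₁ : r₁ ≤ W₁.mordellWeilRank) {e : ℤ} (hiso : TorsionIso W W₁ p)
    (hG : CongruentLambdaShift W W₁ p e) (hb : (b : ℤ) ≤ r₁ + e) : BSDp W p :=
  hX.bsdp_rankZero_of_surj_of_katoHalf_of_firstUnitIndex_of_congruentPartner hK hDel hDelX hPal hGZK hmod
    hmodD hsurj hr ⟨fun _ ↦ hrec, fun h ↦ absurd hp4 (by omega)⟩ hiso hG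
    (fun hκ hγ hγ' D₁ _ ↦
      hX₁.partnerInput_of_katoHalf_of_unitCoeffCert hK hmodD hsurj₁ hp4 hcert₁ hr₁ hκ hγ hγ' D₁)
    hb

end PartnerForms

/-! ### §5 Index `≤ rank E(ℚ)`: the typed (M) LOWER nodes with NO budget (certified MINIMAL rows) -/

section Minimal
variable {W : WeierstrassCurve ℚ} [W.IsElliptic] [W.IsGloballyMinimal] {p : ℕ} [hp : Fact p.Prime]

/-- **X4(M) ∧ surj(p), EVERY odd `p`: a record at an index `b ≤ rank E(ℚ)` gives n1011-p10's node
`QuadraticBranchLowerDivisibilityAt V p` for EVERY twist model `V`, with NO budget** (§0; `b = λ`).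
[cite: Kato2004Asterisque, Thm. 17.4 (3) (p. 273)] [cite: GreenbergLNM1716, §3 Lemma 3.1 (T^{rank} ∣ char)] -/
theorem ClassX4M.forall_quadraticBranchLowerDivisibilityAt_of_katoHalf_of_firstUnitIndex_of_le_rank
    (hK : Wuthrich2014.kato_halfEigenCharIdeal_dvd_cyclotomicPrime_of_surjective)
    (hX : ClassX4M W p) (hsurj : Surj W p) {b : ℕ}
    (hrec : (p % 4 = 1 → MultFirstUnitIndexAt W p b) ∧ (p % 4 = 3 → MultOddFirstUnitIndexAt W p b))
    (hb : b ≤ W.mordellWeilRank) (V : WeierstrassCurve ℚ) [V.IsElliptic] [V.IsGloballyMinimal]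
    (hVW : ∃ C : VariableChange ℚ, C • V.quadraticTwist ((-1) ^ (p / 2) * p : ℚ) = W) :
    QuadraticBranchLowerDivisibilityAt V p :=
  hX.forall_quadraticBranchLowerDivisibilityAt_of_katoHalf_of_firstUnitIndex_of_budget' hK hsurj hrec
    (budgetLeLambdaAt_of_le_mordellWeilRank hb) V hVW

/-- **`p ≡ 1 (mod 4)`: record at index `b ≤ rank E(ℚ)` ⟹ n1011-p06's `ChiBranchRatCharEqMultAt W p`, NO
budget.** [cite: Kato2004Asterisque, Thm. 17.4 (3) (p. 273)] [cite: GreenbergLNM1716, §3 Lemma 3.1] -/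
theorem ClassX4M.chiBranchRatCharEqMultAt_of_katoHalf_of_firstUnitIndex_of_le_rank
    (hK : Wuthrich2014.kato_halfEigenCharIdeal_dvd_cyclotomicPrime_of_surjective)
    (hX : ClassX4M W p) (hsurj : Surj W p) {b : ℕ} (hrec : MultFirstUnitIndexAt W p b)
    (hb : b ≤ W.mordellWeilRank) : ChiBranchRatCharEqMultAt W p :=
  hX.chiBranchRatCharEqMultAt_of_katoHalf_of_firstUnitIndex_of_budget hK hsurj hrec
    (budgetLeLambdaAt_of_le_mordellWeilRank hb)

/-- **`p ≡ 3 (mod 4)` (`p = 3` included): record at index `b ≤ rank E(ℚ)` ⟹ n1011-p06's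
`ChiBranchRatCharEqMultOddAt W p`, NO budget.** [cite: Kato2004Asterisque, Thm. 17.4 (3) (p. 273)]
[cite: GreenbergLNM1716, §3 Lemma 3.1] -/
theorem ClassX4M.chiBranchRatCharEqMultOddAt_of_katoHalf_of_firstUnitIndex_of_le_rank
    (hK : Wuthrich2014.kato_halfEigenCharIdeal_dvd_cyclotomicPrime_of_surjective)
    (hX : ClassX4M W p) (hsurj : Surj W p) {b : ℕ} (hrec : MultOddFirstUnitIndexAt W p b)
    (hb : b ≤ W.mordellWeilRank) : ChiBranchRatCharEqMultOddAt W p :=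
  hX.chiBranchRatCharEqMultOddAt_of_katoHalf_of_firstUnitIndex_of_budget hK hsurj hrec
    (budgetLeLambdaAt_of_le_mordellWeilRank hb)

/-- **T-O7KM's certified rank-ONE (M) rows meet n1011-p10's node: X4(M) ∧ surj(p) ∧ `r_an = 1`, EVERY
odd `p`, record at index `1` (the Q6 `n₀ = 1` record = the T-O7KM certificate) ⟹
`QuadraticBranchLowerDivisibilityAt V p` for every twist model — the typed LOWER hypothesis of n1011-p01's
IMC-version iffs / (M) rank-`1` factorisation HOLDS there** (`rank E(ℚ) = 1` by GZK `hGZK`; `b = 1`).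
[cite: Kato2004Asterisque, Thm. 17.4 (3) (p. 273)] [cite: GreenbergLNM1716, §3 Lemma 3.1] -/
theorem ClassX4M.forall_quadraticBranchLowerDivisibilityAt_of_katoHalf_of_firstUnitIndex_one_rankOne
    (hK : Wuthrich2014.kato_halfEigenCharIdeal_dvd_cyclotomicPrime_of_surjective)
    (hGZK : rank_eq_analyticRank_of_analyticRank_le_one)
    (hX : ClassX4M W p) (hsurj : Surj W p) (hr : W.analyticRank = 1)
    (hrec : (p % 4 = 1 → MultFirstUnitIndexAt W p 1) ∧ (p % 4 = 3 → MultOddFirstUnitIndexAt W p 1))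
    (V : WeierstrassCurve ℚ) [V.IsElliptic] [V.IsGloballyMinimal]
    (hVW : ∃ C : VariableChange ℚ, C • V.quadraticTwist ((-1) ^ (p / 2) * p : ℚ) = W) :
    QuadraticBranchLowerDivisibilityAt V p :=
  hX.forall_quadraticBranchLowerDivisibilityAt_of_katoHalf_of_firstUnitIndex_of_le_rank hK hsurj hrec
    (by rw [(hGZK W (by rw [hr])).1, hr]) V hVW
end Minimal

end Summit.BirchSwinnertonDyer.Rank1Residual.AdditivePotMult

end
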